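import Mathlib
import Summits.RiemannHypothesis.RiemannHypothesis.Theorems.SoloInformedLowPart
import Summits.RiemannHypothesis.RiemannHypothesis.Theorems.SoloInformedPlateau
import Summits.RiemannHypothesis.RiemannHypothesis.Theorems.SoloInformedSpectralCeiling
import HarnessLib

/-!
# T42 — Verified height buys near-positivity of the Weil form on short windows

Solo programme `solo-RiemannHypothesis-informed`, claim T42 (assembly of T42a–c).  This is the
CONVERSE direction of the window ↔ height dictionary of the programme (T39/T40 said: an off-line
zero at height `γ` is visible to the ground energy `ε(a)` only for `a ≳ (1/2η) log log γ`).  Here: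

**Theorem (T42).** Let `RHUpTo T₀` (`T₀ ≥ 1`), `a > 0`, `ψ` a mollifier profile of radius `δ`,
`k ∈ ℕ`, and `h` a height with `log π + 2 S(2a + 2δ) ≤ Re ψ(1/4 + ih/2)`
(`S(b) = Σ_{n ≤ e^b} Λ(n)/√n`).  Then for every test `g` on `[-a, a]`
`Re W(g ⋆ g̃) ≥ -τ ‖g‖₂²`, i.e. `ε(a) ≥ -τ`, with the VERIFIED TARIFF
`τ = 8 log 2 · A₁ · a e^a · D_{k+1}(ψ)² / T₀^{2k} + (W_h - W_0) δ² h² + 4 (e^δ - 1) a e^a`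
(`A₁ = zetaDensityConst`, `D_{k+1}(ψ) = ∫ |ψ^{(k+1)}| e^{|t|/2}`, `W_t = Re ψ(1/4 + it/2)`).

Mechanism: split `K = g ⋆ g̃` as `K ⋆ φ + (K - K ⋆ φ)` with `φ = ψ ⋆ ψ̃`; the low part is read on
the ZERO side (verified zeros contribute `|ĝ|²|ψ̂|² ≥ 0`, unverified ones are killed by the strip
decay `|φ̂(ρ)| ≤ D² |Im ρ|^{-2k-2}`), the high part on the PRIME side (its line density
`|ĝ|²(1 - |ψ̂|²) ≥ 0` vanishes to second order at `t = 0`, so the digamma weight beats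
`log π + 2S` except on `|t| < h`, where `1 - |ψ̂|² ≤ δ² t²`).

**Corollary (T42, qualitative).** `∀ a > 0, ∀ τ > 0, ∃ T₁, ∀ T₀ ≥ T₁, RHUpTo T₀ → ε(a) ≥ -τ`
(`weilGroundEnergy_ge_neg_of_rhUpTo`); in particular `RH → ε(a) ≥ 0` for all `a`
re-derived through the split.  Reading: a verification height `T₀` makes the Weil form
`τ`-positive on windows `a ≤ log log T₀ - O_τ(1)` (the high tariff forces `h ≈ e^{S(2a)}`,
`S(2a) ≍ e^a/a`, and `δ h ≲ √τ`, whence `D_{k+1}² ≳ δ^{-2k-1}` and `T₀ ≳ h^{1+1/2k}`), the mirror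
image of the T39₀ visibility floor `a ≥ (1/2η)(log log γ + O(1))`.
-/

open scoped ContDiff ComplexConjugate Real Topology
open Complex MeasureTheory Set Filter Literature.NumberTheory.LFunctions
  Literature.Analysis.SpecialFunctions

namespace Summit.RiemannHypothesis.RiemannHypothesis.Theorems

variable {g : ℝ → ℂ} {ψ : ℝ → ℝ} {a δ : ℝ}

/-! ### The split inequality -/

/-- **T42 (raw form).** `Re W(g ⋆ g̃) ≥ -E_low - (W_h - W_0) δ² h² ‖g‖₂² - 2(e^δ - 1) e^a ‖g‖₁²`. -/
theorem weilQuadratic_re_ge_of_rhUpTo (hg : IsWeilTest g) (ha : 0 ≤ a)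
    (hsupp : tsupport g ⊆ Icc (-a) a) (hψ : IsMollifier ψ δ) {T₀ : ℝ} (hT₀ : 1 ≤ T₀)
    (hRH : RHUpTo T₀) (k : ℕ) {h : ℝ}
    (hh : Real.log π + 2 * primeSum (2 * a + 2 * δ) ≤ reDigammaQuarter h) :
    -lowErr g ψ a T₀ k
        - (reDigammaQuarter h - reDigammaQuarter 0) * (δ ^ 2 * h ^ 2) * weilNorm2Sq g
        - 2 * (Real.exp δ - 1) * (Real.exp a * weilNorm1 g ^ 2) ≤ (weilQuadratic g).re := by
  have hG₁ := isWeilTest_lowPart hg hψ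
  have hG₂ := isWeilTest_highPart hg hψ
  have hsplit : weilQuadratic g =
      weilFunctional (lowPart g ψ) + weilFunctional (highPart g ψ) := by
    rw [← weilFunctional_add hG₁ hG₂, lowPart_add_highPart]; rfl
  rw [hsplit, Complex.add_re]
  have h1 := weilFunctional_lowPart_re_ge hg ha hsupp hψ hT₀ hRH k
  have h2 := weilFunctional_highPart_re_ge hg hsupp hψ hh
  linarith

/-- The **verified tariff**
`τ = 8 log 2 · A₁ · a e^a D_{k+1}² / T₀^{2k} + (W_h - W_0) δ² h² + 4 (e^δ - 1) a e^a`. -/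
noncomputable def verifiedTariff (ψ : ℝ → ℝ) (a δ T₀ h : ℝ) (k : ℕ) : ℝ :=
  8 * Real.log 2 * zetaDensityConst * a * Real.exp a * weilL1 (deriv^[k + 1] (mollC ψ)) ^ 2 /
        T₀ ^ (2 * k)
    + (reDigammaQuarter h - reDigammaQuarter 0) * (δ ^ 2 * h ^ 2)
    + 4 * (Real.exp δ - 1) * a * Real.exp a

/-- **T42 (tariff form).** `Re W(g ⋆ g̃) ≥ -τ ‖g‖₂²`. -/
theorem weilQuadratic_re_ge_neg_tariff (hg : IsWeilTest g) (ha : 0 < a)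
    (hsupp : tsupport g ⊆ Icc (-a) a) (hψ : IsMollifier ψ δ) {T₀ : ℝ} (hT₀ : 1 ≤ T₀)
    (hRH : RHUpTo T₀) (k : ℕ) {h : ℝ}
    (hh : Real.log π + 2 * primeSum (2 * a + 2 * δ) ≤ reDigammaQuarter h) :
    -(verifiedTariff ψ a δ T₀ h k * weilNorm2Sq g) ≤ (weilQuadratic g).re := by
  have h0 := weilQuadratic_re_ge_of_rhUpTo hg ha.le hsupp hψ hT₀ hRH k hh
  have hX := weilNorm1_sq_le hg ha hsupp
  have hT₀pos : 0 < T₀ := by linarith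
  set D := weilL1 (deriv^[k + 1] (mollC ψ)) with hD
  have hD0 : 0 ≤ D := weilL1_nonneg _
  have hA₁ := zetaDensityConst_pos
  have hl2 : 0 ≤ Real.log 2 := Real.log_nonneg (by norm_num)
  have hδ := hψ.radius_nonneg
  have heδ : 0 ≤ Real.exp δ - 1 := by linarith [Real.one_le_exp hδ]
  have hc₁ : 0 ≤ 4 * Real.log 2 * zetaDensityConst * Real.exp a * D ^ 2 := by positivity
  have hlow : lowErr g ψ a T₀ k ≤
      8 * Real.log 2 * zetaDensityConst * a * Real.exp a * D ^ 2 / T₀ ^ (2 * k) *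
        weilNorm2Sq g := by
    have := mul_le_mul_of_nonneg_left hX hc₁
    calc lowErr g ψ a T₀ k
        = 4 * Real.log 2 * zetaDensityConst * Real.exp a * D ^ 2 * weilNorm1 g ^ 2 /
            T₀ ^ (2 * k) := by rw [lowErr, hD]; ring
      _ ≤ 4 * Real.log 2 * zetaDensityConst * Real.exp a * D ^ 2 * (2 * a * weilNorm2Sq g) /
            T₀ ^ (2 * k) := div_le_div_of_nonneg_right this (by positivity)
      _ = _ := by ring
  have hpol : 2 * (Real.exp δ - 1) * (Real.exp a * weilNorm1 g ^ 2) ≤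
      4 * (Real.exp δ - 1) * a * Real.exp a * weilNorm2Sq g := by
    have hc : 0 ≤ 2 * (Real.exp δ - 1) * Real.exp a := by positivity
    have := mul_le_mul_of_nonneg_left hX hc
    nlinarith
  unfold verifiedTariff
  rw [← hD]
  nlinarith

/-- **T42 (ground energy).** Under `RHUpTo T₀`: `ε(a) ≥ -τ`. -/
theorem weilGroundEnergy_ge_neg_tariff (ha : 0 < a) (hψ : IsMollifier ψ δ) {T₀ : ℝ}
    (hT₀ : 1 ≤ T₀) (hRH : RHUpTo T₀) (k : ℕ) {h : ℝ}
    (hh : Real.log π + 2 * primeSum (2 * a + 2 * δ) ≤ reDigammaQuarter h) :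
    -verifiedTariff ψ a δ T₀ h k ≤ weilGroundEnergy a := by
  refine le_weilGroundEnergy_of_forall ha fun g hg hs hn ↦ ?_
  have := weilQuadratic_re_ge_neg_tariff hg ha hs hψ hT₀ hRH k hh
  rwa [weilNorm2Sq, hn, mul_one] at this

/-! ### Mollifier profiles exist at every radius -/

/-- A function vanishing off a closed set has topological support inside it. -/
theorem tsupport_subset_of_eq_zero {f : ℝ → ℝ} {K : Set ℝ} (hK : IsClosed K)
    (h : ∀ x, x ∉ K → f x = 0) : tsupport f ⊆ K :=
  closure_minimal (fun x hx ↦ by_contra fun hxK ↦ hx (h x hxK)) hK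

/-- **Mollifier profiles exist**: for every `δ > 0` there is a smooth `ψ ≥ 0` of mass one
supported in `[-δ, δ]` (a normalised rescaled plateau `windowPlateau 2 (2x/δ)`). -/
theorem exists_isMollifier (hδ : 0 < δ) : ∃ ψ : ℝ → ℝ, IsMollifier ψ δ := by
  set ψ₀ : ℝ → ℝ := fun x ↦ windowPlateau 2 (2 * x / δ) with hψ₀
  have hcd : ContDiff ℝ ∞ ψ₀ :=
    (contDiff_windowPlateau 2).comp ((contDiff_const.mul contDiff_id).div_const δ)
  have hnn : ∀ x, 0 ≤ ψ₀ x := fun x ↦ windowPlateau_nonneg _ _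
  have hzero : ∀ x, x ∉ Icc (-δ) δ → ψ₀ x = 0 := by
    intro x hx
    apply windowPlateau_eq_zero
    have hx' : δ ≤ |x| := by
      by_contra hlt
      push Not at hlt
      exact hx (abs_le.1 hlt.le)
    rw [abs_div, abs_mul, abs_of_pos hδ, abs_two, le_div_iff₀ hδ]
    linarith
  have hcs : HasCompactSupport ψ₀ := HasCompactSupport.intro isCompact_Icc hzero
  have hI : 0 < ∫ x, ψ₀ x := by
    refine hcd.continuous.integral_pos_of_hasCompactSupport_nonneg_nonzero hcs hnn (x := 0) ?_
    simp only [hψ₀, mul_zero, zero_div]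
    rw [windowPlateau_eq_one (by norm_num)]; norm_num
  refine ⟨fun x ↦ ψ₀ x / ∫ x, ψ₀ x, ⟨hcd.div_const _, fun x ↦ div_nonneg (hnn x) hI.le, ?_, ?_⟩⟩
  · rw [integral_div, div_self hI.ne']
  · exact tsupport_subset_of_eq_zero isClosed_Icc fun x hx ↦ by
      simp only [hzero x hx, zero_div]

/-! ### The qualitative corollary -/

/-- `S(b)` is monotone in `b`. -/
theorem primeSum_mono {b b' : ℝ} (h : b ≤ b') : primeSum b ≤ primeSum b' := by
  unfold primeSum
  apply Finset.sum_le_sum_of_subset_of_nonneg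
  · exact Finset.range_mono (by
      have := Nat.floor_mono (Real.exp_le_exp.2 h); omega)
  · intro n _ _
    exact div_nonneg ArithmeticFunction.vonMangoldt_nonneg (Real.sqrt_nonneg _)
        |> fun h ↦ by exact_mod_cast h

/-- There are heights with `Re ψ(1/4 + ih/2)` as large as desired. -/
theorem exists_le_reDigammaQuarter (L : ℝ) : ∃ h : ℝ, 0 ≤ h ∧ L ≤ reDigammaQuarter h := by
  obtain ⟨C, hC⟩ := exists_log_sub_le_reDigammaQuarter
  refine ⟨2 * Real.exp (L + C), by positivity, ?_⟩
  refine le_trans ?_ (hC _)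
  have hpos : 0 < Real.exp (L + C) := Real.exp_pos _
  rw [abs_of_pos (by positivity), le_sub_iff_add_le]
  calc L + C = Real.log (Real.exp (L + C)) := (Real.log_exp _).symm
    _ ≤ Real.log (1 + 2 * Real.exp (L + C) / 2) :=
        Real.log_le_log hpos (by linarith)

/-- **T42 (qualitative corollary).** For every window `a > 0` and every `τ > 0` there is a
height `T₁` such that verifying the Riemann hypothesis up to any `T₀ ≥ T₁` forces
`ε(a) ≥ -τ`. -/
theorem weilGroundEnergy_ge_neg_of_rhUpTo (ha : 0 < a) {τ : ℝ} (hτ : 0 < τ) :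
    ∃ T₁ : ℝ, ∀ T₀ : ℝ, T₁ ≤ T₀ → RHUpTo T₀ → -τ ≤ weilGroundEnergy a := by
  -- the height `h`
  set L : ℝ := Real.log π + 2 * primeSum (2 * a + 2) with hL
  obtain ⟨h, h0, hLh⟩ := exists_le_reDigammaQuarter L
  set W : ℝ := reDigammaQuarter h - reDigammaQuarter 0 with hW
  have hW0 : 0 ≤ W := by
    have := reDigammaQuarter_mono (t := h) (u := 0) (by simp)
    linarith
  have hea : 0 < a * Real.exp a := by positivity
  -- the radius `δ`
  set δ : ℝ := min 1 (min (τ / (3 * (W * h ^ 2 + 1))) (τ / (3 * (8 * (a * Real.exp a) + 1))))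
    with hδdef
  have hδpos : 0 < δ := by positivity
  have hδ1 : δ ≤ 1 := min_le_left _ _
  have hδ2 : δ ≤ τ / (3 * (W * h ^ 2 + 1)) := (min_le_right _ _).trans (min_le_left _ _)
  have hδ3 : δ ≤ τ / (3 * (8 * (a * Real.exp a) + 1)) :=
    (min_le_right _ _).trans (min_le_right _ _)
  obtain ⟨ψ, hψ⟩ := exists_isMollifier hδpos
  -- the height condition
  have hh : Real.log π + 2 * primeSum (2 * a + 2 * δ) ≤ reDigammaQuarter h :=
    le_trans (by have := primeSum_mono (show 2 * a + 2 * δ ≤ 2 * a + 2 by linarith); linarith)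
      hLh
  -- the two `δ`-terms are `≤ τ/3` each
  have hterm2 : W * (δ ^ 2 * h ^ 2) ≤ τ / 3 := by
    have hsq : δ ^ 2 ≤ δ := by nlinarith
    have h1 : W * (δ ^ 2 * h ^ 2) ≤ (W * h ^ 2) * δ := by
      have := mul_le_mul_of_nonneg_left hsq (show 0 ≤ W * h ^ 2 by positivity)
      linarith [show W * (δ ^ 2 * h ^ 2) = W * h ^ 2 * δ ^ 2 by ring]
    have h2 : (W * h ^ 2) * δ ≤ (W * h ^ 2) * (τ / (3 * (W * h ^ 2 + 1))) :=
      mul_le_mul_of_nonneg_left hδ2 (by positivity)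
    have h3 : (W * h ^ 2) * (τ / (3 * (W * h ^ 2 + 1))) ≤ τ / 3 := by
      rw [mul_div_assoc', div_le_div_iff₀ (by positivity) (by norm_num)]
      nlinarith [sq_nonneg h]
    linarith
  have hterm3 : 4 * (Real.exp δ - 1) * a * Real.exp a ≤ τ / 3 := by
    have he : Real.exp δ - 1 ≤ 2 * δ := by
      have := Real.abs_exp_sub_one_sub_id_le (by rw [abs_of_pos hδpos]; exact hδ1)
      have h' := (abs_le.1 this).2
      nlinarith
    have h1 : 4 * (Real.exp δ - 1) * a * Real.exp a ≤ 8 * (a * Real.exp a) * δ := by nlinarith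
    have h2 : 8 * (a * Real.exp a) * δ ≤ 8 * (a * Real.exp a) * (τ / (3 * (8 * (a * Real.exp a) + 1))) :=
      mul_le_mul_of_nonneg_left hδ3 (by positivity)
    have h3 : 8 * (a * Real.exp a) * (τ / (3 * (8 * (a * Real.exp a) + 1))) ≤ τ / 3 := by
      rw [mul_div_assoc', div_le_div_iff₀ (by positivity) (by norm_num)]
      nlinarith
    linarith
  -- the height threshold: `k = 1`, `Q / T₀² ≤ τ/3`
  set Q : ℝ := 8 * Real.log 2 * zetaDensityConst * a * Real.exp a *
      weilL1 (deriv^[1 + 1] (mollC ψ)) ^ 2 with hQ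
  have hQ0 : 0 ≤ Q := by
    have := zetaDensityConst_pos
    have := weilL1_nonneg (deriv^[1 + 1] (mollC ψ))
    have : 0 ≤ Real.log 2 := Real.log_nonneg (by norm_num)
    positivity
  refine ⟨max 1 (3 * Q / τ + 1), fun T₀ hT₀ hRH ↦ ?_⟩
  have hT1 : 1 ≤ T₀ := (le_max_left _ _).trans hT₀
  have hT2 : 3 * Q / τ + 1 ≤ T₀ := (le_max_right _ _).trans hT₀
  have hT₀pos : 0 < T₀ := by linarith
  have hterm1 : Q / T₀ ^ (2 * 1) ≤ τ / 3 := by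
    have hsq : T₀ ≤ T₀ ^ (2 * 1) := by
      rw [show 2 * 1 = 2 from rfl, sq]; nlinarith
    have h1 : Q / T₀ ^ (2 * 1) ≤ Q / T₀ := div_le_div_of_nonneg_left hQ0 hT₀pos hsq
    have h2 : Q / T₀ ≤ Q / (3 * Q / τ + 1) :=
      div_le_div_of_nonneg_left hQ0 (by positivity) hT2
    have h3 : Q / (3 * Q / τ + 1) ≤ τ / 3 := by
      rw [div_le_div_iff₀ (by positivity) (by norm_num)]
      have : τ * (3 * Q / τ + 1) = 3 * Q + τ := by field_simp
      nlinarith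
    linarith
  have hmain := weilGroundEnergy_ge_neg_tariff ha hψ hT1 hRH 1 hh
  have hτle : verifiedTariff ψ a δ T₀ h 1 ≤ τ := by
    unfold verifiedTariff
    rw [← hQ, ← hW]
    linarith
  linarith

/-- In particular the split re-derives the easy direction of Weil's criterion for the ground
energy: `RH → ε(a) ≥ 0` for every `a > 0`. -/
theorem weilGroundEnergy_nonneg_of_riemannHypothesis' (hRH : RiemannHypothesis) (ha : 0 < a) :
    0 ≤ weilGroundEnergy a := by
  by_contra hlt
  push Not at hlt
  obtain ⟨T₁, hT₁⟩ := weilGroundEnergy_ge_neg_of_rhUpTo ha (τ := -weilGroundEnergy a / 2)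
    (by linarith)
  have := hT₁ T₁ le_rfl (rhUpTo_of_riemannHypothesis hRH T₁)
  linarith

end Summit.RiemannHypothesis.RiemannHypothesis.Theorems
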